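import Summits.NavierStokesRegularity.NavierStokesRegularity.Theorems.OddMorawetzLocal.Negative.OddMorawetzLocalRefutationDefsV

/-!
# Crux `OddMorawetzLocal` (stmt-NavierStokesRegularity-1376) — refutation vocabulary VI: row-chunked certificate
checks

Definitions only. At weight 5 the one-shot kernel checks `blockCheck` (a 45–53-row block of the rank certificate) and
`isoCertCheck` (the 50 × 50 independence certificate) exceed the kernel's memory budget in a single `decide`; the
row-chunked twins below check the SAME identities `minor · inverse = 1 (mod p)` and `S_K · C = 1 (mod p)` on a range of
rows `[lo, lo + n)`, so that each block is certified by a few theorems. `minorColsF` is `minorCols` with the derivation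
columns normalised (`normF`) before coefficient extraction (same coefficients, by `coeffOf_normF`).
-/

set_option linter.dupNamespace false
set_option autoImplicit false

namespace Summit.NavierStokesRegularity.NavierStokesRegularity.Theorems.OddMorawetz

/-- The columns of a block minor of the derivation matrix on orbit sums, with each derivation column brought to fast
normal form before its coefficients are read (reduced mod `p`). -/
def minorColsF (k : ℕ) (L : Matrix (Fin 3) (Fin 3) ℤ) (reps : List (List JVar)) (rs cs : List ℕ) (p : ℕ) :
    List (List ℕ) :=
  cs.map fun c =>
    let col := JPoly.normF (JPoly.derP L (orbitSumN (reps.getD c [])))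
    rs.map fun i => Int.toNat ((JPoly.coeffOf col ((idx k).getD i [])) % (p : ℤ))

/-- Row-chunked block certificate check: rows `lo … lo+n-1` of `minor · inv (mod p)` are the corresponding rows of
the identity matrix (`inv` given by rows). -/
def blockCheckRows (k : ℕ) (L : Matrix (Fin 3) (Fin 3) ℤ) (reps : List (List JVar)) (rs cs : List ℕ)
    (inv : List (List ℕ)) (p lo n : ℕ) : Bool :=
  let rows := colsToRows (minorColsF k L reps rs cs p) rs.length
  let invCols := colsToRows inv inv.length
  (List.range' lo n).all fun a => (List.range rs.length).all fun b =>
    (List.zipWith (· * ·) (rows.getD a []) (invCols.getD b [])).foldr (fun x acc => (x + acc) % p) 0 =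
      (if a = b then 1 else 0)

/-- Row-chunked independence certificate check of the isotropic basis in orbit coordinates: rows `lo … lo+n-1` of
`S_K · C (mod p)` are the corresponding rows of the identity matrix (`cinv` given by rows). -/
def isoCertCheckRows (reps : List (List JVar)) (iso : List IsoDesc) (kcols : List ℕ) (cinv : List (List ℕ))
    (p lo n : ℕ) : Bool :=
  let cinvCols := colsToRows cinv cinv.length
  (List.range' lo n).all fun l =>
    let row := kcols.map fun c => Int.toNat ((JPoly.coeffOf (isoPolyF (iso.getD l (.poly []))) (reps.getD c [])) % (p : ℤ))
    (List.range iso.length).all fun l' =>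
      (List.zipWith (· * ·) row (cinvCols.getD l' [])).foldr (fun x acc => (x + acc) % p) 0 = (if l = l' then 1 else 0)

end Summit.NavierStokesRegularity.NavierStokesRegularity.Theorems.OddMorawetz
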